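import Summits.AtomisticToContinuum.FouriersLaw.Theses.BoundaryEscapeDeficit

/-!
# `BoundaryEscapeDeficit.EscapeLawOfCruxes` — proved

Item `stmt-AtomisticToContinuum-12242` (support, route `BoundaryEscapeDeficit`, sub-problem `FouriersLaw`):
the MESH of the route's second layer,
`HalfChainTailLaw → DiffusiveCrossover → EscapeNonOscillation → EscapeLaw`.

Argument (pure real analysis, the same one inlined in the route's deciding theorem `closes`):
evaluate the tail law at `t = a₁N²` and `t = a₀N²` (both `≥ t₀` for large `N`), pick ONE common
witness `M` of the three `∀ᶠ M` filters, and bracket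
`γc₂c/(2√a₁) ≤ (N−1)γE_N ≤ γ·max(C₂,0)·C/√a₀` eventually in `N`; the `EReal` limit furnished by
`EscapeNonOscillation` is then squeezed between two real numbers, hence real (`EReal.coe_toReal`),
`≥ γc₂c/(2√a₁) > 0`, and it is the real limit (`EReal.tendsto_coe`).
-/

namespace Summit.AtomisticToContinuum.FouriersLaw.Theorems

open Filter Topology

/-- **Abstract mesh lemma** (pure real analysis). If a family of curves `θ M` obeys the two-sided
tail bracket `c/√t ≤ 1 − θ_M(t) ≤ C/√t` (for `t ≥ t₀`, eventually in `M`, with `c > 0`), a real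
sequence `E` obeys the crossover bracket `c₂(1 − θ_M(a₁N²)) ≤ E_N ≤ C₂(1 − θ_M(a₀N²))` (eventually
in `N`, then eventually in `M`, with `a₀, a₁, c₂ > 0`), and `(N−1)·γ·E_N` has a limit in `EReal`,
then `(N−1)·γ·E_N` converges to a real `κb > 0`. -/
theorem escapeLaw_mesh (E : ℕ → ℝ) (θ : ℕ → ℝ → ℝ) (γ c C t₀ a₀ a₁ c₂ C₂ : ℝ)
    (hγ : 0 < γ) (hc : 0 < c) (ha₀ : 0 < a₀) (ha₁ : 0 < a₁) (hc₂ : 0 < c₂)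
    (hTail : ∀ t : ℝ, t₀ ≤ t → ∀ᶠ M : ℕ in Filter.atTop,
      c / Real.sqrt t ≤ 1 - θ M t ∧ 1 - θ M t ≤ C / Real.sqrt t)
    (hCross : ∀ᶠ N : ℕ in Filter.atTop, ∀ᶠ M : ℕ in Filter.atTop,
      c₂ * (1 - θ M (a₁ * (N : ℝ) ^ 2)) ≤ E N ∧ E N ≤ C₂ * (1 - θ M (a₀ * (N : ℝ) ^ 2)))
    (hNO : ∃ ℓ : EReal, Filter.Tendsto (fun N : ℕ => ((((N : ℝ) - 1) * γ * E N : ℝ) : EReal))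
      Filter.atTop (nhds ℓ)) :
    ∃ κb : ℝ, 0 < κb ∧
      Filter.Tendsto (fun N : ℕ => ((N : ℝ) - 1) * γ * E N) Filter.atTop (nhds κb) := by
  obtain ⟨ℓ, hℓ⟩ := hNO
  have hsa₁ : 0 < Real.sqrt a₁ := Real.sqrt_pos.2 ha₁
  have hsa₀ : 0 < Real.sqrt a₀ := Real.sqrt_pos.2 ha₀
  -- Step 1: the eventual two-sided bracket.
  have hbounds : ∀ᶠ N : ℕ in Filter.atTop,
      γ * c₂ * c / (2 * Real.sqrt a₁) ≤ ((N : ℝ) - 1) * γ * E N ∧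
        ((N : ℝ) - 1) * γ * E N ≤ γ * max C₂ 0 * C / Real.sqrt a₀ := by
    have hN2 : ∀ᶠ N : ℕ in Filter.atTop, (2 : ℝ) ≤ N := by
      filter_upwards [Filter.eventually_ge_atTop 2] with N hN
      exact_mod_cast hN
    have hsq : Filter.Tendsto (fun N : ℕ => (N : ℝ) ^ 2) Filter.atTop Filter.atTop :=
      (tendsto_pow_atTop two_ne_zero).comp tendsto_natCast_atTop_atTop
    have ht1 : ∀ᶠ N : ℕ in Filter.atTop, t₀ ≤ a₁ * (N : ℝ) ^ 2 :=
      (Filter.Tendsto.const_mul_atTop ha₁ hsq).eventually_ge_atTop t₀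
    have ht0 : ∀ᶠ N : ℕ in Filter.atTop, t₀ ≤ a₀ * (N : ℝ) ^ 2 :=
      (Filter.Tendsto.const_mul_atTop ha₀ hsq).eventually_ge_atTop t₀
    filter_upwards [hN2, ht1, ht0, hCross] with N hN h1 h0 hX
    have hNpos : (0 : ℝ) < N := by linarith
    -- one common witness M of the three `∀ᶠ M` statements
    obtain ⟨M, hM1, hM0, hMX⟩ := ((hTail _ h1).and ((hTail _ h0).and hX)).exists
    have hsq1 : Real.sqrt (a₁ * (N : ℝ) ^ 2) = Real.sqrt a₁ * N := by
      rw [Real.sqrt_mul ha₁.le, Real.sqrt_sq hNpos.le]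
    have hsq0 : Real.sqrt (a₀ * (N : ℝ) ^ 2) = Real.sqrt a₀ * N := by
      rw [Real.sqrt_mul ha₀.le, Real.sqrt_sq hNpos.le]
    rw [hsq1] at hM1
    rw [hsq0] at hM0
    have hElow : c₂ * (c / (Real.sqrt a₁ * N)) ≤ E N :=
      le_trans (mul_le_mul_of_nonneg_left hM1.1 hc₂.le) hMX.1
    have hEnn : 0 ≤ E N := le_trans (by positivity) hElow
    have hy : 0 ≤ 1 - θ M (a₀ * (N : ℝ) ^ 2) := le_trans (by positivity) hM0.1
    have hEup : E N ≤ max C₂ 0 * (C / (Real.sqrt a₀ * N)) :=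
      le_trans hMX.2 (le_trans (mul_le_mul_of_nonneg_right (le_max_left _ _) hy)
        (mul_le_mul_of_nonneg_left hM0.2 (le_max_right _ _)))
    constructor
    · have hN1 : (N : ℝ) / 2 ≤ (N : ℝ) - 1 := by linarith
      have hfac : 0 ≤ γ * (c₂ * (c / (Real.sqrt a₁ * N))) := by positivity
      calc γ * c₂ * c / (2 * Real.sqrt a₁)
          = (N : ℝ) / 2 * (γ * (c₂ * (c / (Real.sqrt a₁ * N)))) := by
            field_simp
        _ ≤ ((N : ℝ) - 1) * (γ * (c₂ * (c / (Real.sqrt a₁ * N)))) :=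
            mul_le_mul_of_nonneg_right hN1 hfac
        _ = ((N : ℝ) - 1) * γ * (c₂ * (c / (Real.sqrt a₁ * N))) := by ring
        _ ≤ ((N : ℝ) - 1) * γ * E N :=
            mul_le_mul_of_nonneg_left hElow (by nlinarith)
    · have hγE : 0 ≤ γ * E N := mul_nonneg hγ.le hEnn
      calc ((N : ℝ) - 1) * γ * E N ≤ (N : ℝ) * γ * E N := by nlinarith
        _ ≤ (N : ℝ) * γ * (max C₂ 0 * (C / (Real.sqrt a₀ * N))) :=
            mul_le_mul_of_nonneg_left hEup (by positivity)
        _ = γ * max C₂ 0 * C / Real.sqrt a₀ := by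
            field_simp
  -- Step 2: squeeze the EReal limit into [L, U]; it is real, ≥ L > 0, and is the real limit.
  have hLpos : 0 < γ * c₂ * c / (2 * Real.sqrt a₁) := by positivity
  have hℓ_ge : ((γ * c₂ * c / (2 * Real.sqrt a₁) : ℝ) : EReal) ≤ ℓ :=
    ge_of_tendsto hℓ (hbounds.mono fun N h => EReal.coe_le_coe_iff.2 h.1)
  have hℓ_le : ℓ ≤ ((γ * max C₂ 0 * C / Real.sqrt a₀ : ℝ) : EReal) :=
    le_of_tendsto hℓ (hbounds.mono fun N h => EReal.coe_le_coe_iff.2 h.2)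
  have hℓ_top : ℓ ≠ ⊤ := ne_top_of_le_ne_top (EReal.coe_ne_top _) hℓ_le
  have hℓ_bot : ℓ ≠ ⊥ := ne_bot_of_le_ne_bot (EReal.coe_ne_bot _) hℓ_ge
  refine ⟨ℓ.toReal, ?_, ?_⟩
  · rw [← EReal.coe_toReal hℓ_top hℓ_bot, EReal.coe_le_coe_iff] at hℓ_ge
    exact lt_of_lt_of_le hLpos hℓ_ge
  · rw [← EReal.coe_toReal hℓ_top hℓ_bot] at hℓ
    exact EReal.tendsto_coe.1 hℓ

/-- **`BoundaryEscapeDeficit.EscapeLawOfCruxes`, PROVED** (item stmt-AtomisticToContinuum-12242): the three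
analytic cruxes of the second layer — the half-line boundary tail law, the diffusive crossover and the bare
non-oscillation of `(N−1)·γ·E_N` in `EReal` — give the escape law `X_b(E)`: `(N−1)·γ·E_N → κ_b(T) ∈ (0, ∞)`.
The `let`-bound `K`, `θ`, `E` of the four route decls are syntactically identical and are zeta-reduced by
`dsimp only`; the rest is `escapeLaw_mesh`. [cite: BonettoLebowitzReyBellet2000, §5.3 (33) (framing only)] -/
theorem escapeLawOfCruxes_proof :
    Summit.AtomisticToContinuum.FouriersLaw.Theses.BoundaryEscapeDeficit.EscapeLawOfCruxes := by
  unfold Summit.AtomisticToContinuum.FouriersLaw.Theses.BoundaryEscapeDeficit.EscapeLawOfCruxes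
  intro hT hC hNO ω₂ lam β γ hω hl hβ hγ T hT0
  have h1 := hT ω₂ lam β γ hω hl hβ hγ T hT0
  have h2 := hC ω₂ lam β γ hω hl hβ hγ T hT0
  have h3 := hNO ω₂ lam β γ hω hl hβ hγ T hT0
  dsimp only at h1 h2 h3 ⊢
  obtain ⟨c, C, t₀, hc, -, hTail⟩ := h1
  obtain ⟨a₀, a₁, c₂, C₂, ha₀, ha₁, hc₂, hCross⟩ := h2
  exact escapeLaw_mesh _ _ γ c C t₀ a₀ a₁ c₂ C₂ hγ hc ha₀ ha₁ hc₂ hTail hCross h3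

end Summit.AtomisticToContinuum.FouriersLaw.Theorems
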